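import Summits.QuantumFields.BalabanUV.T4Continuum.Support.ShellMeasureLandauEndAssembledDecayCfLin
import Summits.QuantumFields.BalabanUV.T4Continuum.Support.ShellMeasureLandauEndBlockSpace

/-!
# `T4Continuum.ShellMeasureLandauEndAssembledDecayCfLinWitnessNumbers` — the NUMBERS of the (x1) witness for the linear-chart host
# (`ShellMeasureLandauEndAssembledDecayCfLinWitness`, ROW S104 f3): OUR toy scheme constants as CLOSED TERMS in the tree's [B7] Prop. 4 constants
# `C0 c2′ O1cov C2cov landauRad` and R10's `C₄c`, with every number row of S104 f2's host proved ONCE here in a small context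
(cell `pub-balaban`, sub-cell `t4`, spine estimate NE7c (node U5b); NE7c ROUND-2 crew, unit
`b2b-balaban-t4-ne7c-formalise-leaf-02` gen 11; journal OFFER l.21457; ADDITIVE — imports S104 f2 `…AssembledDecayCfLin` (for
`C2cov`, `landauRad`, `C0`, `c2′`, `O1cov` BY NAME through its imports) and R10 f1 `…BlockSpace` (`C₄c`) ONLY; [folklore]; data
`def`s `tS twS α₀S ampT εθ₃`, 0 `def … : Prop`, 0 sorry, 0 citation tags)

HONEST FRAMING.  Arithmetic on OUR toy numbers (which inequalities between the tree's explicit [B7] constants a joint-inhabitation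
example can satisfy); nothing about Bałaban's minimiser, propagators, kernels or densities; no printed estimate used or asserted.
Finite four-torus programme, rung (B)+1 only — NOT infinite volume, NOT a mass gap, NOT the Clay problem, NOT summit progress;
NE7c (`T4IndicatorShell.ShellWeightBound`) NOT PRINTED, NOT PROVED; «NE7c ⇐ the named binders» (c3).  HONEST DEPENDENCY (cell):
continuum YM on T⁴ ⇐ BetaPertH ∧ nine spine estimates (0/9 proved); BetaPertH ⇐ (D1) ∧ (D4) ∧ CAP+tail; G-an2-4 gates asym, D1
and NE2/3/4.

* `tS d′ L := min 1 (min (8∕(9(C2cov d′+1))) (16·landauRad d′ L∕3))` — the u-tuple scale (`h18`, `h3R`, `h2` want it);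
  `twS d′ L := min (1∕6) (min (landauRad∕12) (1∕(36(C2cov+1))))` — the w∕e-tuple letter size (`hdomw hqw hRCw hdome hqe hRCe hcoupE`);
  `α₀S d′ L := min (c2′∕4) (min (1∕(3C0)) (1∕(12·O1cov)))` — the background-regularity number (`hα hα3 hα4 hα6`);
  `ampT d d′ L := t∕16 + C2cov·t²∕(64(C₄c d+1))` — the read-out amplitude WITH the quadratic `C2cov` term; `εθ₃` — the (SM)
  threshold at chart radius `(tη∕384)∕S`; positivity ∕ bounds (`ampT ≤ 11∕144`), the rows `row_h3 row_fixedPoint row_h18 row_h3R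
  row_we`, and the window arithmetic **`εθ₃_eta_sq_le`**: `S ≤ t²η²∕10⁸ ⟹ εθ₃·η² ≤ S∕12`.
-/

noncomputable section

namespace Summit.QuantumFields.BalabanUV.T4Continuum.ShellMeasureLandauEndAssembledDecayCfLinWitnessNumbers

open Literature.MathematicalPhysics.QuantumFieldTheory.Balaban1983to89
open B7Prop2Explicit (C0 c2' C0_pos c2'_pos)
open ShellMeasureAverageProp4General (O1cov C2cov C1cov_pos O1cov_pos)
open ShellMeasureLandauCfPinned (C2cov_nonneg)
open ShellMeasureLandauCorrectionB7 (landauRad landauRad_pos)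
open ShellMeasureLandauEndBlockSpace (C₄c C₄c_nonneg)

/-! ## OUR toy numbers as closed terms in the tree's [B7] constants -/

section Numbers
variable (d d' L : ℕ)

/-- the u-tuple scale `t := min 1 (min (8∕(9(C2cov+1))) (16·landauRad∕3))`. [folklore] -/
def tS : ℝ := min 1 (min (8 / (9 * (C2cov d' + 1))) (16 * landauRad d' L / 3))

/-- the w∕e-tuple letter size `min (1∕6) (min (landauRad∕12) (1∕(36(C2cov+1))))`. [folklore] -/
def twS : ℝ := min (1 / 6) (min (landauRad d' L / 12) (1 / (36 * (C2cov d' + 1))))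

/-- the background-regularity number `α₀ := min (c2′∕4) (min (1∕(3C0)) (1∕(12·O1cov)))`. [folklore] -/
def α₀S : ℝ := min (c2' d' L / 4) (min (1 / (3 * C0 d')) (1 / (12 * O1cov d')))

/-- the read-out amplitude `z̄ = t∕16 + C2cov·t²∕(64(C₄c d + 1))` (the quadratic Landau term with the tree's `C2cov`). [folklore] -/
def ampT : ℝ := tS d' L / 16 + C2cov d' * tS d' L ^ 2 / (64 * (C₄c d + 1))

/-- the (SM) threshold (unit currency; classifier threshold `εθ₃·η²`) at the chart radius `(tη∕384)∕S`. [folklore] -/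
def εθ₃ (S η : ℝ) : ℝ :=
  72 * (ampT d d' L / η ^ 2 * 1 + ((1 : ℕ) : ℝ) ^ 2 * (ampT d d' L / η) ^ 2 * 1 ^ 2) / ((tS d' L * η / 384) / S - 1) ^ 2

variable {d d' L}

/-- `0 < t`. [folklore] -/
theorem tS_pos (hL : 1 ≤ L) : 0 < tS d' L := by
  have h1 := C2cov_nonneg d'; have h2 := landauRad_pos d' hL
  unfold tS; exact lt_min one_pos (lt_min (by positivity) (by positivity))

/-- `t ≤ 1`. [folklore] -/
theorem tS_le_one : tS d' L ≤ 1 := min_le_left _ _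

/-- `t ≤ 8∕(9(C2cov+1))`. [folklore] -/
theorem tS_le_cov : tS d' L ≤ 8 / (9 * (C2cov d' + 1)) := (min_le_right _ _).trans (min_le_left _ _)

/-- `t ≤ 16·landauRad∕3`. [folklore] -/
theorem tS_le_rad : tS d' L ≤ 16 * landauRad d' L / 3 := (min_le_right _ _).trans (min_le_right _ _)

/-- `0 < tw`. [folklore] -/
theorem twS_pos (hL : 1 ≤ L) : 0 < twS d' L := by
  have h1 := C2cov_nonneg d'; have h2 := landauRad_pos d' hL
  unfold twS; exact lt_min (by norm_num) (lt_min (by positivity) (by positivity))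

/-- `tw ≤ 1∕6`. [folklore] -/
theorem twS_le_sixth : twS d' L ≤ 1 / 6 := min_le_left _ _

/-- `tw ≤ landauRad∕12`. [folklore] -/
theorem twS_le_rad : twS d' L ≤ landauRad d' L / 12 := (min_le_right _ _).trans (min_le_left _ _)

/-- `tw ≤ 1∕(36(C2cov+1))`. [folklore] -/
theorem twS_le_cov : twS d' L ≤ 1 / (36 * (C2cov d' + 1)) := (min_le_right _ _).trans (min_le_right _ _)

/-- `C2cov·tw ≤ 1∕36`. [folklore] -/
theorem C2cov_mul_twS_le : C2cov d' * twS d' L ≤ 1 / 36 := by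
  have hC := C2cov_nonneg d'
  calc C2cov d' * twS d' L ≤ C2cov d' * (1 / (36 * (C2cov d' + 1))) := mul_le_mul_of_nonneg_left twS_le_cov hC
    _ = (C2cov d' / (C2cov d' + 1)) / 36 := by field_simp
    _ ≤ 1 / 36 := by gcongr; rw [div_le_one (by positivity)]; linarith

/-- `C2cov·t ≤ 8∕9`. [folklore] -/
theorem C2cov_mul_tS_le : C2cov d' * tS d' L ≤ 8 / 9 := by
  have hC := C2cov_nonneg d'
  calc C2cov d' * tS d' L ≤ C2cov d' * (8 / (9 * (C2cov d' + 1))) := mul_le_mul_of_nonneg_left tS_le_cov hC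
    _ = (C2cov d' / (C2cov d' + 1)) * (8 / 9) := by field_simp
    _ ≤ 1 * (8 / 9) := by gcongr; rw [div_le_one (by positivity)]; linarith
    _ = 8 / 9 := one_mul _

/-- `0 < α₀`. [folklore] -/
theorem α₀S_pos (hL : 1 ≤ L) : 0 < α₀S d' L := by
  have h1 := c2'_pos d' L hL; have h2 := C0_pos d'; have h3 := O1cov_pos d'
  unfold α₀S; exact lt_min (by positivity) (lt_min (by positivity) (by positivity))

/-- `0 < z̄ ≤ 11∕144` (for `d ≥ 1`, `L ≥ 1`). [folklore] -/
theorem ampT_bounds (hd1 : 1 ≤ d) (hL : 1 ≤ L) : 0 < ampT d d' L ∧ ampT d d' L ≤ 11 / 144 := by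
  have ht := tS_pos (d' := d') hL; have ht1 := tS_le_one (d' := d') (L := L)
  have hC := C₄c_nonneg d hd1; have hCc := C2cov_nonneg d'; have hct := C2cov_mul_tS_le (d' := d') (L := L)
  refine ⟨by unfold ampT; positivity, ?_⟩
  have h2 : C2cov d' * tS d' L ^ 2 / (64 * (C₄c d + 1)) ≤ C2cov d' * tS d' L ^ 2 / 64 :=
    div_le_div_of_nonneg_left (by positivity) (by norm_num) (by linarith)
  have h3 : C2cov d' * tS d' L ^ 2 ≤ 8 / 9 * tS d' L := by nlinarith
  unfold ampT; nlinarith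

/-- `0 < εθ₃` in the window `S < tη∕384`. [folklore] -/
theorem εθ₃_pos (hd1 : 1 ≤ d) (hL : 1 ≤ L) {S η : ℝ} (hS : 0 < S) (hη : 0 < η) (hSr : S < tS d' L * η / 384) :
    0 < εθ₃ d d' L S η := by
  have h1 : 1 < (tS d' L * η / 384) / S := by rw [lt_div_iff₀ hS]; linarith
  have h2 : 0 < (tS d' L * η / 384) / S - 1 := by linarith
  have h4 := (ampT_bounds (d' := d') hd1 hL).1
  unfold εθ₃; positivity

/-! ### The number rows of the host at these data (proved once here, in a small context) -/

/-- `h3`: `16·B₀·C₄·ε₄ ≤ 1` for `B₀ = 1∕(C+1)`, `ε₄ = t∕32`, `t ≤ 1`. [folklore] -/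
theorem row_h3 {C t : ℝ} (hC : 0 ≤ C) (ht0 : 0 ≤ t) (ht1 : t ≤ 1) : 16 * (1 / (C + 1)) * C * (t / 32) ≤ 1 := by
  rw [show 16 * (1 / (C + 1)) * C * (t / 32) = t * (C / (2 * (C + 1))) by field_simp; ring]
  have : C / (2 * (C + 1)) ≤ 1 := by rw [div_le_one (by positivity)]; linarith
  nlinarith

/-- B11 Prop. 6's fixed-point rows for `rdL_solAt_eq_zero` at `ε₄ = t∕32`, `a = t∕64`. [folklore] -/
theorem row_fixedPoint {C t : ℝ} (hC : 0 ≤ C) (ht0 : 0 ≤ t) (ht1 : t ≤ 1) :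
    2 * (t / 32 + t / 64) ≤ 1 / 8 ∧ 1 / (C + 1) * C * (t / 32 + t / 64) ^ 2 ≤ t / 32 ∧
      4 * (1 / (C + 1)) * C * (t / 32 + t / 64) < 1 := by
  have h9 : C / (C + 1) ≤ 1 := by rw [div_le_one (by positivity)]; linarith
  have h9' : 0 ≤ C / (C + 1) := by positivity
  refine ⟨by linarith, ?_, ?_⟩
  · rw [show 1 / (C + 1) * C * (t / 32 + t / 64) ^ 2 = (t * (9 * t / 4096)) * (C / (C + 1)) by field_simp; ring]
    nlinarith [mul_nonneg ht0 (by positivity : (0:ℝ) ≤ 9 * t / 4096)]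
  · rw [show 4 * (1 / (C + 1)) * C * (t / 32 + t / 64) = (3 * t / 16) * (C / (C + 1)) by field_simp; ring]
    nlinarith

/-- `h18`: `18·C2cov·B₀·(t∕16) ≤ 1` for `0 ≤ B₀ ≤ 1`. [folklore] -/
theorem row_h18 (hL : 1 ≤ L) {B : ℝ} (hB1 : B ≤ 1) : 18 * C2cov d' * B * (tS d' L / 16) ≤ 1 := by
  have hCc := C2cov_nonneg d'; have ht := C2cov_mul_tS_le (d' := d') (L := L); have ht0 := (tS_pos (d' := d') hL).le
  calc 18 * C2cov d' * B * (tS d' L / 16) ≤ 18 * C2cov d' * 1 * (tS d' L / 16) := by gcongr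
    _ = (9 / 8) * (C2cov d' * tS d' L) := by ring
    _ ≤ 1 := by nlinarith

/-- `h3R`: `3·(t∕16) ≤ landauRad`. [folklore] -/
theorem row_h3R : 3 * (tS d' L / 16) ≤ landauRad d' L := by
  have := tS_le_rad (d' := d') (L := L); linarith

/-- the w∕e-tuple rows `hdomw hqw hRCw hdome hqe hRCe hcoupE` at letters `twS`. [folklore] -/
theorem row_we (hL : 1 ≤ L) :
    2 * (twS d' L + 1 * twS d' L) ≤ 2 / 3 ∧ 9 * C2cov d' * 1 * (twS d' L + 1 * twS d' L) < 1 ∧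
      6 * (twS d' L + 1 * twS d' L) ≤ landauRad d' L ∧
      9 * (C2cov d' * Real.exp (2 * 0 * 0)) * 1 * (twS d' L + 1 * twS d' L) < 1 ∧
      3 * (twS d' L + 1 * twS d' L) ≤ landauRad d' L ∧
      (twS d' L + 1 * twS d' L) + 1 * (4 * (C2cov d' * Real.exp (2 * 0 * 0)) * (twS d' L + 1 * twS d' L) ^ 2) ≤ 1 / 2 := by
  have h0 := twS_pos (d' := d') hL; have h6 := twS_le_sixth (d' := d') (L := L)
  have hr := twS_le_rad (d' := d') (L := L); have hc := C2cov_mul_twS_le (d' := d') (L := L)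
  have hCc := C2cov_nonneg d'
  rw [show (2 : ℝ) * 0 * 0 = 0 by ring, Real.exp_zero, mul_one]
  refine ⟨by linarith, by nlinarith, by linarith, by nlinarith, by linarith, ?_⟩
  nlinarith [mul_le_mul_of_nonneg_right hc h0.le]

end Numbers


/-! ### The window arithmetic: the (SM) threshold sits inside the core radius for `S ≤ t²η²∕10⁸` -/

/-- **`εθ₃·η² ≤ S∕12`** for `d ≥ 1`, `L ≥ 1`, `0 < η ≤ 1`, `0 < S ≤ t²η²∕10⁸` (`εθ₃·η² = 72(z̄+z̄²)∕(R−1)²`, `72(z̄+z̄²) ≤ 6`,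
`R = tη∕(384S)`, `R − 1 ≥ tη∕(768S)`, `6·12·768² = 42 467 328 ≤ 10⁸`). [folklore] -/
theorem εθ₃_eta_sq_le {d d' L : ℕ} (hd1 : 1 ≤ d) (hL : 1 ≤ L) {S η : ℝ} (hη : 0 < η) (hη1 : η ≤ 1) (hS : 0 < S)
    (hSb : S ≤ tS d' L ^ 2 * η ^ 2 / 10 ^ 8) : εθ₃ d d' L S η * η ^ 2 ≤ S / 12 := by
  obtain ⟨hA0, hA1⟩ := ampT_bounds (d := d) (d' := d') (L := L) hd1 hL
  have ht0 := tS_pos (d' := d') hL; have ht1 := tS_le_one (d' := d') (L := L)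
  have hA : 72 * (ampT d d' L + ampT d d' L ^ 2) ≤ 6 := by nlinarith
  have htη : 0 < tS d' L * η := mul_pos ht0 hη
  have htη1 : tS d' L * η ≤ 1 := by nlinarith
  have hsq : tS d' L ^ 2 * η ^ 2 ≤ tS d' L * η := by nlinarith
  have hS8 : S ≤ tS d' L * η / 10 ^ 8 := hSb.trans (div_le_div_of_nonneg_right hsq (by norm_num))
  have hR : 2 ≤ (tS d' L * η / 384) / S := by rw [le_div_iff₀ hS]; linarith
  have hD : tS d' L * η / (768 * S) ≤ (tS d' L * η / 384) / S - 1 := by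
    have : tS d' L * η / (768 * S) = ((tS d' L * η / 384) / S) / 2 := by field_simp; ring
    rw [this]; linarith
  have hDpos : 0 < (tS d' L * η / 384) / S - 1 := by linarith
  have hval : εθ₃ d d' L S η * η ^ 2 = 72 * (ampT d d' L + ampT d d' L ^ 2) / ((tS d' L * η / 384) / S - 1) ^ 2 := by
    unfold εθ₃; field_simp; ring
  rw [hval, div_le_iff₀ (pow_pos hDpos 2)]
  calc 72 * (ampT d d' L + ampT d d' L ^ 2) ≤ 6 := hA
    _ ≤ S / 12 * (tS d' L * η / (768 * S)) ^ 2 := by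
        rw [show S / 12 * (tS d' L * η / (768 * S)) ^ 2 = (tS d' L * η) ^ 2 / (7077888 * S) by field_simp; ring]
        rw [le_div_iff₀ (by positivity)]
        nlinarith
    _ ≤ S / 12 * ((tS d' L * η / 384) / S - 1) ^ 2 := by gcongr

end Summit.QuantumFields.BalabanUV.T4Continuum.ShellMeasureLandauEndAssembledDecayCfLinWitnessNumbers

end
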